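import Mathlib
import Literature.NumberTheory.LFunctions.Zhang2022.Section17R1PrimeBulkPointwise
import Literature.NumberTheory.LFunctions.Zhang2022.Section17SummedError
import HarnessLib

/-!
# Zhang (2022) §17.u021, remainder `R₁`, piece M2L-p BULK: the `ν⁻`-part and the cutoff-perturbation
# part summed over the outer weights (blueprint Steps D1–D2)

Topic `Literature/NumberTheory/LFunctions/Zhang2022` (Landau–Siegel audit tree; verdict-neutral).
Y. Zhang, *Discrete mean estimates and the Landau–Siegel zero*, arXiv:2211.02515v1 (2022)
[Zhang2022LandauSiegel] — **an unrefereed manuscript under adjudication**; nothing here asserts or denies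
its Theorems 1–2. §17 p. 98 (u021; no bound in print). Piece M2L-p BULK of the sub-leaf `R₁` (WP16 leaf
h17_9; blueprint `wp16/zl-w16-p3/R1-BULK-PLAN.md`). For the first and third terms of
`Section17R1PrimeBulkPointwise.norm_nuOneStar_prime_arg_le` (`2‖ν⁻(q₂)‖` and `2δ·4τ₄(q₂)`), which do
not depend on `p`, the `p`-sum factors as `H_P = Σ_{p∈P} 1/p` and the outer count is the tree's
Hall–Tenenbaum pair (`Section17NuOneStarMajorant.sum_F1_div_le`: prime value `4`, `(log X)⁴`;
`sum_F2_div_le`: prime value `12`, `(log X)¹²`; bridges `Section17SummedError.F1_apply/F2_apply`):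

  `Σ_{1≤l≤X} |ν(l)|/l Σ_{l=q₁q₂} τ₂(q₁) Σ_{p∈P} (2‖ν⁻(q₂)‖ + 8δτ₄(q₂))/p
     ≤ H_P · (2·M₄,₆(log X)⁴ + 8δ·M₁₂,₈(log X)¹²)`.

Theorems only; axioms standard.

## References

* Y. Zhang, arXiv:2211.02515v1 (2022), §17 p. 98 (u021). [cite: Zhang2022LandauSiegel, §17 u021 p.98]
* R. R. Hall, G. Tenenbaum, *Divisors*, CUP 1988, (0.4). [cite: HallTenenbaum1988, (0.4)]
-/

noncomputable section

open Complex Real Finset ArithmeticFunction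
open Literature.NumberTheory.LFunctions.Zhang2022.Skeleton
open Literature.NumberTheory.LFunctions.Zhang2022.Typed.Section17
open Literature.NumberTheory.LFunctions.Zhang2022.MeanSquareMajorant

namespace Literature.NumberTheory.LFunctions.Zhang2022.Phi3Eval

variable {D : ℕ} (χ : DirichletCharacter ℂ D)

/-- **Blueprint Steps D1–D2**: for a real `χ`, `X ≥ 2`, `δ ≥ 0` and any finite `P ⊆ ℕ`,
`Σ_{1≤l≤X} |ν(l)|/l Σ_{l=q₁q₂} τ₂(q₁) Σ_{p∈P} (2‖ν⁻(q₂)‖ + 8δτ₄(q₂))/p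
  ≤ (Σ_{p∈P} 1/p)·(2·majorantConst 4 6·(log X)⁴ + 8δ·majorantConst 12 8·(log X)¹²)`.
[cite: Zhang2022LandauSiegel, §17 u021 p.98] -/
theorem bulk_main_pert_sum_le (hχ : χ.IsQuadratic) {X : ℕ} (hX : 2 ≤ X) {δ : ℝ} (hδ : 0 ≤ δ)
    (P : Finset ℕ) :
    ∑ l ∈ Finset.Icc 1 X, ‖nu χ l‖ / l * ∑ q ∈ l.divisorsAntidiagonal, tau 2 q.1 *
        ∑ p ∈ P, (2 * ‖∑ d ∈ q.2.divisors, (ArithmeticFunction.moebius d : ℂ) * χ (d : ZMod D)‖ +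
          2 * δ * (4 * tau 4 q.2)) / p ≤
      (∑ p ∈ P, (1 : ℝ) / p) *
        (2 * (majorantConst 4 6 * Real.log X ^ 4) + 8 * δ * (majorantConst 12 8 * Real.log X ^ 12)) := by
  classical
  set H : ℝ := ∑ p ∈ P, (1 : ℝ) / p with hH
  have hH0 : 0 ≤ H := Finset.sum_nonneg fun p _ => by positivity
  set F₁ : ℕ → ℝ := fun l => ((normAF ((ArithmeticFunction.zeta : ArithmeticFunction ℂ) *
        toArithmeticFunction (fun n : ℕ => χ (n : ZMod D)))).pmul
      (tau 2 * normAF (((ArithmeticFunction.moebius : ArithmeticFunction ℂ).pmul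
        (toArithmeticFunction (fun n : ℕ => χ (n : ZMod D)))) *
          (ArithmeticFunction.zeta : ArithmeticFunction ℂ)))) l with hF₁
  set F₂ : ℕ → ℝ := fun l => ((normAF ((ArithmeticFunction.zeta : ArithmeticFunction ℂ) *
        toArithmeticFunction (fun n : ℕ => χ (n : ZMod D)))).pmul (tau 6)) l with hF₂
  have hF₁0 : ∀ l, 0 ≤ F₁ l := fun l =>
    (isBlock_pmul (isBlock_normAF_nu χ) ((isBlock_tau 2).mul (isBlock_normAF_moebiusChi_mul_zeta χ))).nonneg l
  have hF₂0 : ∀ l, 0 ≤ F₂ l := fun l => (isBlock_pmul (isBlock_normAF_nu χ) (isBlock_tau 6)).nonneg l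
  -- the `p`-sum factors: `Σ_p c/p = c·H`
  have hp_sum : ∀ c : ℝ, ∑ p ∈ P, c / p = c * H := fun c => by
    rw [hH, Finset.mul_sum]
    exact Finset.sum_congr rfl fun p _ => by rw [mul_one_div]
  -- termwise identity
  have hterm : ∀ l ∈ Finset.Icc 1 X, ‖nu χ l‖ / l * ∑ q ∈ l.divisorsAntidiagonal, tau 2 q.1 *
      ∑ p ∈ P, (2 * ‖∑ d ∈ q.2.divisors, (ArithmeticFunction.moebius d : ℂ) * χ (d : ZMod D)‖ +
        2 * δ * (4 * tau 4 q.2)) / p = H * (2 * F₁ l + 8 * δ * F₂ l) / l := by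
    intro l _
    simp only [hp_sum]
    have heq : ‖nu χ l‖ * ∑ q ∈ l.divisorsAntidiagonal, tau 2 q.1 *
        ((2 * ‖∑ d ∈ q.2.divisors, (ArithmeticFunction.moebius d : ℂ) * χ (d : ZMod D)‖ +
          2 * δ * (4 * tau 4 q.2)) * H) = H * (2 * F₁ l + 8 * δ * F₂ l) := by
      simp only [hF₁, hF₂, F1_apply, F2_apply, Finset.mul_sum, ← Finset.sum_add_distrib]
      exact Finset.sum_congr rfl fun q _ => by ring
    rw [div_mul_eq_mul_div, heq]
  rw [Finset.sum_congr rfl hterm]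
  -- the two counts
  have h1 := sum_F1_div_le χ hχ hX
  have h2 := sum_F2_div_le χ hχ hX
  calc ∑ l ∈ Finset.Icc 1 X, H * (2 * F₁ l + 8 * δ * F₂ l) / l
      = H * (2 * ∑ l ∈ Finset.Icc 1 X, F₁ l / l + 8 * δ * ∑ l ∈ Finset.Icc 1 X, F₂ l / l) := by
        rw [Finset.mul_sum, Finset.mul_sum, ← Finset.sum_add_distrib, Finset.mul_sum]
        exact Finset.sum_congr rfl fun l _ => by ring
    _ ≤ H * (2 * (majorantConst 4 6 * Real.log X ^ 4) + 8 * δ * (majorantConst 12 8 * Real.log X ^ 12)) := by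
        refine mul_le_mul_of_nonneg_left (add_le_add ?_ ?_) hH0
        · exact mul_le_mul_of_nonneg_left h1 (by norm_num)
        · exact mul_le_mul_of_nonneg_left h2 (by positivity)

end Literature.NumberTheory.LFunctions.Zhang2022.Phi3Eval
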